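import Summits.Ventures.QEC.Thresholds.RotatedSurfaceCodeSAWThresholdsZ
import Summits.Ventures.QEC.Thresholds.PlanarSurfaceCodePhenomSAWThresholds
import Literature.InformationTheory.QuantumCodes.RotatedSurfaceCodeDrawingZ
import HarnessLib
-- buildfix (bf3-g30) G30-26: comment-only touch to re-dispatch the lane build (dead-lettered rc 76 (att 7, last 20:24 08-27 / 06:01 08-28) behind Literature.InformationTheory.QuantumCodes.ToricCodeErasureHalfGeometry whose hub olean is fresh; root and file farm rc 0 now (lane datum: host-local stale dependency olean); no build event for 9-19 h); declarations byte-identical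

/-!
# Rotated surface codes `RSC(L) = [[L², 1, L]]` with NOISY syndrome measurement (`q = p`, polynomially many rounds), `H_Z`
# sector (bit flips, noisy `Z`-syndrome): the space-time SAW-counting threshold `p₀(μ(ℤ³)) > .0112` for every minimum-weight /
# space-time-MWPM decoder family, EVERY `L` — unconditional, tier CERTIFIED (kernel); both sectors together

Venture QEC, `Summits/Ventures/QEC/Thresholds/` (LADDER-QEC rung Q5, PARTITION row 09 "phenomenological"; qec-type-09 gen 7, cell
item «09.RSCPH», second sector). `RotatedSurfaceCodePhenomSAWThresholds.lean` (this item) certifies the `H_X` sector of the rotated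
memory experiment at `p₀(4.7476) > .0112`. The `H_Z` sector of `RSC(L)` is NOT a coordinate permutation of the `H_X` sector when
`L` is even (the colour classes differ in size), so it needs its own drawing: `RotatedSurfaceCodeDrawingZ.lean` packages gen 6's
second lift (`RotatedSurfaceCodeLiftZ.lean`: `Z`-faces at `zsite`, qubits as `zbond`, rough edges = the qubit ROWS `0` / `L-1`)
as a `CheckDrawing` of the whole matrix `HZ L` and, through the generic space-time lift, proves
`Prob[odd row-0 projected residual] ≤ L·T·C·r^L/(1-r)` under `cₙ(ℤ³) ≤ C νⁿ`. This file packages the consequences for the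
`X`-sector family `xPhenomFailureFamily rscCode T D` (item 143: `p₀(5) ≈ .0101`):

| theorem | statement | tier |
|---|---|---|
| `rsc_phenomZ_oddResidual_of_not_corrects`, `rsc_xPhenomFailureFamily_le_of_sawCountBound3` | failure ⇒ the residual history projects to a chain with an odd number of row-`0` qubits (`rsc_rowZero_eq_one`); `P_fail(i) ≤ (i+1)·T(i)·C·r^{i+1}/(1-r)` | CERTIFIED (kernel) |
| `rsc_x_phenom_isThresholdLowerBound_of_sawCountBound3`, `…_of_connectiveConstant_three_le` | `cₙ(ℤ³) ≤ C νⁿ ⇒ p_c ≥ p₀(ν)`; `μ(ℤ³) ≤ μ' ⇒ p_c ≥ p₀(μ')` (every polynomially bounded schedule, every minimum-weight space-time decoder family of the `H_Z` sector) | CERTIFIED (kernel), parametric |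
| ★ `rsc_x_phenom_isThresholdLowerBound_kernelZ3SymmK12`, ★ `rsc_x_phenom_accuracyThreshold_gt_0112`, `rsc_x_phenom_accuracyThreshold_stMinWeight_gt_0112`, `rsc_x_phenom_decaysExponentially_0112`, `rsc_x_phenom_mwpm_isThresholdLowerBound_kernelZ3SymmK12`, `rsc_x_phenom_mwpm_accuracyThreshold_gt_0112` | **`p_c^phenom(RSC, H_Z sector) > .0112`** at `μ(ℤ³) ≤ 4.7476` (was `.0101`), every size `L`, every minimum-weight space-time decoder family, in particular space-time boundary-MWPM; exponential decay for `p ≤ .0112` | CERTIFIED (kernel), unconditional |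
| (with the `H_X` file's `rsc_z_phenom_belowThreshold_0112`) | BOTH records of the rotated memory experiment `→ 0` at every `p < .0112` for every pair of minimum-weight space-time decoder families (this file proves the `H_Z` half `rsc_x_phenom_belowThreshold_0112`; it deliberately does not import the `H_X` file) | CERTIFIED (kernel), unconditional |

HONEST FRAMING. Certified LOWER bounds, one error type at a time (sector-wise minimum-weight space-time decoding, `q = p`);
decimals are kernel consequences of the memory-12 certificate `μ(ℤ³) ≤ 4.7476`. NOT asserted: DKLP's printed `.0114`, the numerical
`.0293` (Wang–Harrington–Preskill 2003), circuit-level numbers for Surface-17/49/97. No `native_decide`, no named fact.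

## References

* [DennisEtAl2002] E. Dennis, A. Kitaev, A. Landahl, J. Preskill, *Topological quantum memory*, J. Math. Phys. 43 (2002)
  4452–4505, arXiv:quant-ph/0110143, §4.1 (X and Z errors treated separately), §4.2–4.3, §5.1, §5.2–5.3 (eqs. (e_ineq),
  (saw_L), (saw_3), (threshold_iso), (fail_iso), (threshold_iso_num); relative polygons of planar codes).
* [TomitaSvore2014] Y. Tomita, K. M. Svore, PRA 90 (2014) 062320, §2.2 (Surface-17, the rotated layout).
* [WangHarringtonPreskill2003] C. Wang, J. Harrington, J. Preskill, Ann. Phys. 303 (2003) 31–58, abstract (`p_{c0} = .0293`).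
* [PonitzTittmann2000] Electron. J. Combin. 7 (2000) R21, Table 2 (`d = 3, k = 12`).
-/

noncomputable section

namespace Summit.Ventures.QEC.Thresholds

open Filter Topology Finset Matrix
open Literature.InformationTheory.QuantumCodes
open Literature.InformationTheory.QuantumCodes.RotatedSurface
open Literature.InformationTheory.QuantumCodes.ToricCode (SAWCountBound3 IsPolyBounded)
open Literature.Probability.RandomPlanarGeometry

/-! ### Failure leaves an odd row-`0` projected residual; the finite-size bound -/

/-- **Failure of the memory experiment ⇒ odd row-`0` projected residual.** If a minimum-weight space-time decoder `D` of
the `T`-round experiment of the `H_Z` sector of `RSC(L)` (`L ≥ 1`) fails on the history `E` (the net residual `Π(D(∂E) + E)`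
is a NON-TRIVIAL `X`-logical), the projection of the residual has an odd number of qubits in row `0` (`Π` of a space-time
cycle is undetectable, `CSSPhenom.mulVec_proj_eq_zero`; one encoded qubit, `rsc_rowZero_eq_one`).
[cite: DennisEtAl2002, §4.3 (success iff the residual is homologically trivial) and §6.1 (the projection Π)] -/
theorem rsc_phenomZ_oddResidual_of_not_corrects {L : ℕ} (hL : 0 < L) (T : ℕ)
    {D : CSSPhenom.STDecoder (Fin (L - 1) × Fin (L + 1)) (Fin L × Fin L) T}
    (hD : D.IsMinWeight (CSSPhenom.stSyn (HZ L) T) (CSSPhenom.stCycles (HZ L) T) hammingNorm)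
    {E : CSSPhenom.History (Fin (L - 1) × Fin (L + 1)) (Fin L × Fin L) T}
    (hfail : ¬ D.Corrects (CSSPhenom.stSyn (HZ L) T)
      (CSSPhenom.stTrivial ((RotatedSurface.code L).rowSpX : Set (Fin L × Fin L → ZMod 2)) T) E) :
    ∑ i : Fin L, CSSPhenom.proj (D (CSSPhenom.stSyn (HZ L) T E) + E) (⟨0, hL⟩, i) = 1 := by
  have hc : CSSPhenom.stMatrix (HZ L) T *ᵥ (D (CSSPhenom.stSyn (HZ L) T E) + E) = 0 := hD.add_mem E
  exact rsc_rowZero_eq_one hL (CSSPhenom.mulVec_proj_eq_zero hc) hfail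

open Classical in
/-- The failure probability of the memory experiment is at most the probability of an odd row-`0` projected residual.
[cite: DennisEtAl2002, §5.2 (Prob_fail ≤ the probability of a non-trivial (relative) space-time polygon)] -/
theorem rsc_xPhenomFailureFamily_le_sum_oddResidual (T : ℕ → ℕ)
    (D : ∀ i, CSSPhenom.STDecoder (Fin (i + 1 - 1) × Fin (i + 1 + 1)) (Fin (i + 1) × Fin (i + 1)) (T i))
    (hD : ∀ i, (D i).IsMinWeight (CSSPhenom.stSyn (rscCode i).HZ (T i)) (CSSPhenom.stCycles (rscCode i).HZ (T i))
      hammingNorm)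
    (i : ℕ) {p : ℝ} (hp0 : 0 ≤ p) (hp1 : p ≤ 1) :
    xPhenomFailureFamily rscCode T D i p ≤
      ∑ E ∈ univ.filter (fun E : CSSPhenom.History (Fin (i + 1 - 1) × Fin (i + 1 + 1)) (Fin (i + 1) × Fin (i + 1)) (T i) =>
        ∑ j : Fin (i + 1), CSSPhenom.proj (D i (CSSPhenom.stSyn (HZ (i + 1)) (T i) E) + E) (⟨0, by omega⟩, j) = 1),
        phenomenologicalWeight (T i) p p (supp E) := by
  refine Finset.sum_le_sum_of_subset_of_nonneg (fun E hE => ?_) fun E _ _ => ?_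
  · rw [Finset.mem_filter] at hE ⊢
    exact ⟨Finset.mem_univ _, rsc_phenomZ_oddResidual_of_not_corrects (by omega) (T i) (hD i) hE.2⟩
  · rw [ToricCode.phenomenologicalWeight_self]
    exact bernoulliWeight_nonneg hp0 hp1 _

/-- ★ **DKLP's finite-size bound for the rotated-surface-code memory experiment, proved**: under `cₙ(ℤ³) ≤ C νⁿ` (`ν > 0`), for
every minimum-weight space-time decoder family of the `H_Z` sector, every `0 ≤ p ≤ 1/2` (`q = p`) with `r = 2ν√(p(1-p)) < 1`:
`P_fail(i) ≤ (i+1)·T(i)·C·r^{i+1}/(1-r)` (relative form of eq. (fail_iso) on the rotated cubic lattice, our constants).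
[cite: DennisEtAl2002, §5.3 eq. (fail_iso)] -/
theorem rsc_xPhenomFailureFamily_le_of_sawCountBound3 {C ν : ℝ} (hν : 0 < ν) (hC : SAWCountBound3 C ν) (T : ℕ → ℕ)
    (D : ∀ i, CSSPhenom.STDecoder (Fin (i + 1 - 1) × Fin (i + 1 + 1)) (Fin (i + 1) × Fin (i + 1)) (T i))
    (hD : ∀ i, (D i).IsMinWeight (CSSPhenom.stSyn (rscCode i).HZ (T i)) (CSSPhenom.stCycles (rscCode i).HZ (T i))
      hammingNorm)
    (i : ℕ) {p : ℝ} (hp0 : 0 ≤ p) (hp : p ≤ 1 / 2) (hr1 : 2 * ν * Real.sqrt (p * (1 - p)) < 1) :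
    xPhenomFailureFamily rscCode T D i p ≤ ((i + 1 : ℕ) : ℝ) * (T i) * C * (2 * ν * Real.sqrt (p * (1 - p))) ^ (i + 1) /
      (1 - 2 * ν * Real.sqrt (p * (1 - p))) :=
  (rsc_xPhenomFailureFamily_le_sum_oddResidual T D hD i hp0 (by linarith)).trans
    (rsc_stZ_sum_oddResidual_le (L := i + 1) (by omega) hν hC (hD i) hp0 hp hr1)

/-- **Below threshold for `4ν² p(1-p) < 1`** (given `cₙ(ℤ³) ≤ C νⁿ`, `ν > 0`, polynomially many rounds): the rotated
memory-experiment failure probability tends to `0`, for every minimum-weight space-time decoder family of the `H_Z` sector.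
[cite: DennisEtAl2002, §5.3 eq. (threshold_iso)] -/
theorem rsc_x_phenom_belowThreshold_of_sawCountBound3 {C ν : ℝ} (hν : 0 < ν) (hC : SAWCountBound3 C ν) {T : ℕ → ℕ}
    (hT : IsPolyBounded T)
    (D : ∀ i, CSSPhenom.STDecoder (Fin (i + 1 - 1) × Fin (i + 1 + 1)) (Fin (i + 1) × Fin (i + 1)) (T i))
    (hD : ∀ i, (D i).IsMinWeight (CSSPhenom.stSyn (rscCode i).HZ (T i)) (CSSPhenom.stCycles (rscCode i).HZ (T i))
      hammingNorm)
    {p : ℝ} (hp0 : 0 ≤ p) (hp : p ≤ 1 / 2) (h4 : 4 * ν ^ 2 * (p * (1 - p)) < 1) :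
    BelowThreshold (xPhenomFailureFamily rscCode T D) p := by
  have ht := rsc_stZ_tendsto_sum_oddResidual hν hC hT D hD hp0 hp h4
  refine squeeze_zero' (Filter.Eventually.of_forall fun i => ?_)
    (Filter.Eventually.of_forall fun i => rsc_xPhenomFailureFamily_le_sum_oddResidual T D hD i hp0 (by linarith)) ht
  refine Finset.sum_nonneg fun E _ => ?_
  rw [ToricCode.phenomenologicalWeight_self]
  exact bernoulliWeight_nonneg hp0 (by linarith) _

/-! ### `p₀(ν)`, `p₀(μ')`, and the kernel certificate `μ(ℤ³) ≤ 4.7476`: `p_c^phenom(RSC) > .0112` -/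

/-- **Rotated phenomenological threshold `≥ p₀(ν)` from `cₙ(ℤ³) ≤ C νⁿ`** (`ν ≥ 1`), every polynomially bounded schedule and
minimum-weight space-time decoder family of the `H_Z` sector. [cite: DennisEtAl2002, §5.3 eqs. (threshold_iso), (threshold_iso_num)] -/
theorem rsc_x_phenom_isThresholdLowerBound_of_sawCountBound3 {C ν : ℝ} (hν : 1 ≤ ν) (hC : SAWCountBound3 C ν)
    {T : ℕ → ℕ} (hT : IsPolyBounded T)
    (D : ∀ i, CSSPhenom.STDecoder (Fin (i + 1 - 1) × Fin (i + 1 + 1)) (Fin (i + 1) × Fin (i + 1)) (T i))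
    (hD : ∀ i, (D i).IsMinWeight (CSSPhenom.stSyn (rscCode i).HZ (T i)) (CSSPhenom.stCycles (rscCode i).HZ (T i))
      hammingNorm) :
    IsThresholdLowerBound (xPhenomFailureFamily rscCode T D) (thresholdValue ν) := by
  intro p hp₀ hpp
  have hp : p ≤ 1 / 2 := hpp.le.trans (thresholdValue_le_half ν)
  have hlt : p * (1 - p) < thresholdValue ν * (1 - thresholdValue ν) :=
    mul_one_sub_lt_mul_one_sub hpp (by linarith [thresholdValue_le_half ν])
  have hν0 : 0 < ν := lt_of_lt_of_le one_pos hν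
  have h4 : 4 * ν ^ 2 * (p * (1 - p)) < 1 := by
    calc 4 * ν ^ 2 * (p * (1 - p)) < 4 * ν ^ 2 * (thresholdValue ν * (1 - thresholdValue ν)) := by gcongr
      _ = 1 := four_mul_sq_mul_thresholdValue hν
  exact rsc_x_phenom_belowThreshold_of_sawCountBound3 hν0 hC hT D hD hp₀ hp h4

/-- **Rotated phenomenological threshold from any bound on `μ(ℤ³)`** (tier = that of the bound): if `μ(ℤ³) ≤ μ'`, `μ' ≥ 1`,
then `p₀(μ')` is a threshold lower bound (every polynomially bounded schedule, every minimum-weight space-time decoder family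
of the `H_Z` sector). [cite: DennisEtAl2002, §5.3 eqs. (saw_3), (threshold_iso)] -/
theorem rsc_x_phenom_isThresholdLowerBound_of_connectiveConstant_three_le {μ' : ℝ} (hμ'1 : 1 ≤ μ')
    (hμ : SAW.Zd.connectiveConstant 3 ≤ μ') {T : ℕ → ℕ} (hT : IsPolyBounded T)
    (D : ∀ i, CSSPhenom.STDecoder (Fin (i + 1 - 1) × Fin (i + 1 + 1)) (Fin (i + 1) × Fin (i + 1)) (T i))
    (hD : ∀ i, (D i).IsMinWeight (CSSPhenom.stSyn (rscCode i).HZ (T i)) (CSSPhenom.stCycles (rscCode i).HZ (T i))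
      hammingNorm) :
    IsThresholdLowerBound (xPhenomFailureFamily rscCode T D) (thresholdValue μ') := by
  refine isThresholdLowerBound_thresholdValue_of_forall_gt hμ'1 fun ν hν p hp0 hp h4 => ?_
  obtain ⟨C, hC⟩ := exists_sawCountBound3_of_connectiveConstant_lt (lt_of_le_of_lt hμ hν)
  exact rsc_x_phenom_belowThreshold_of_sawCountBound3 (by linarith) hC hT D hD hp0 hp h4

/-- ★ **Rotated surface codes, noisy measurement, `H_Z` sector: threshold `≥ p₀(4.7476)`, UNCONDITIONAL, tier CERTIFIED
(kernel)**: every polynomially bounded schedule of rounds, every minimum-weight space-time decoder family (`q = p`), from the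
kernel-checked symmetry-reduced memory-12 bound `μ(ℤ³) ≤ 4.7476` (was `p₀(5)`, item 143).
[cite: DennisEtAl2002, §5.3 eqs. (saw_3), (threshold_iso_num)] [cite: PonitzTittmann2000, Table 2 (d = 3, k = 12)] -/
theorem rsc_x_phenom_isThresholdLowerBound_kernelZ3SymmK12 {T : ℕ → ℕ} (hT : IsPolyBounded T)
    (D : ∀ i, CSSPhenom.STDecoder (Fin (i + 1 - 1) × Fin (i + 1 + 1)) (Fin (i + 1) × Fin (i + 1)) (T i))
    (hD : ∀ i, (D i).IsMinWeight (CSSPhenom.stSyn (rscCode i).HZ (T i)) (CSSPhenom.stCycles (rscCode i).HZ (T i))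
      hammingNorm) :
    IsThresholdLowerBound (xPhenomFailureFamily rscCode T D) (thresholdValue 4.7476) :=
  rsc_x_phenom_isThresholdLowerBound_of_connectiveConstant_three_le (by norm_num)
    SAW.Zd.FiniteMemory3.connectiveConstant_three_le_47476 hT D hD

/-- ★ **`p_c^phenom(RSC, H_Z sector) > .0112`** (`q = p`, polynomially many rounds, every minimum-weight space-time decoder
family) — UNCONDITIONAL, tier CERTIFIED (kernel); was `.0101` (item 143). DKLP's printed `.0114` and the numerical `.0293`
(Wang–Harrington–Preskill) are CLAIMS, not asserted. [cite: DennisEtAl2002, §5.3 eq. (threshold_iso_num)]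
[cite: WangHarringtonPreskill2003, abstract (p_c0 = .0293 ± .0002, numerical)] -/
theorem rsc_x_phenom_accuracyThreshold_gt_0112 {T : ℕ → ℕ} (hT : IsPolyBounded T)
    (D : ∀ i, CSSPhenom.STDecoder (Fin (i + 1 - 1) × Fin (i + 1 + 1)) (Fin (i + 1) × Fin (i + 1)) (T i))
    (hD : ∀ i, (D i).IsMinWeight (CSSPhenom.stSyn (rscCode i).HZ (T i)) (CSSPhenom.stCycles (rscCode i).HZ (T i))
      hammingNorm) :
    (0.0112 : ℝ) < accuracyThreshold (xPhenomFailureFamily rscCode T D) :=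
  lt_of_lt_of_le thresholdValue_47476_bounds.1
    (le_accuracyThreshold (rsc_x_phenom_isThresholdLowerBound_kernelZ3SymmK12 hT D hD)
      ((thresholdValue_le_half _).trans (by norm_num)))

/-- The canonical instance: MINIMUM-WEIGHT SPACE-TIME DECODING of the rotated memory experiment has `p_c > .0112` —
UNCONDITIONAL, tier CERTIFIED (kernel). [cite: DennisEtAl2002, §5.1 eq. (E_min) and §5.3] -/
theorem rsc_x_phenom_accuracyThreshold_stMinWeight_gt_0112 {T : ℕ → ℕ} (hT : IsPolyBounded T) :
    (0.0112 : ℝ) < accuracyThreshold (xPhenomFailureFamily rscCode T fun i =>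
      Decoder.minWeight (CSSPhenom.stSyn (rscCode i).HZ (T i)) hammingNorm) :=
  rsc_x_phenom_accuracyThreshold_gt_0112 hT _ fun i =>
    Decoder.isMinWeight_minWeight _ _ _
      (fun y z h => by
        show CSSPhenom.stMatrix (rscCode i).HZ (T i) *ᵥ (y - z) = 0
        have h' : CSSPhenom.stMatrix (rscCode i).HZ (T i) *ᵥ y = CSSPhenom.stMatrix (rscCode i).HZ (T i) *ᵥ z := h
        rw [Matrix.mulVec_sub, h', sub_self])
      fun x => by rw [show -x = x from funext fun i => ZMod.neg_eq_self_mod_two (x i)]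

/-- **Exponential decay below `p₀(ν)`** (given `cₙ(ℤ³) ≤ C νⁿ`, `ν ≥ 1`, polynomially many rounds): for every minimum-weight
space-time decoder family of the `H_Z` sector and every `0 ≤ p < p₀(ν)` (`q = p`), `P_fail(i) ≤ C' r'^i` for some `C'`,
`r' < 1` (from `(i+1)·T(i)·C·r^{i+1}/(1-r) ≤ (ACr/(1-r))·(i+1)^{m+1}·r^i` when `T(i) ≤ A (i+1)^m`).
[cite: DennisEtAl2002, §5.3 eq. (fail_iso) and the sentence after it] -/
theorem rsc_x_phenom_decaysExponentially_of_sawCountBound3 {C ν : ℝ} (hν : 1 ≤ ν) (hC : SAWCountBound3 C ν)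
    {T : ℕ → ℕ} (hT : IsPolyBounded T)
    (D : ∀ i, CSSPhenom.STDecoder (Fin (i + 1 - 1) × Fin (i + 1 + 1)) (Fin (i + 1) × Fin (i + 1)) (T i))
    (hD : ∀ i, (D i).IsMinWeight (CSSPhenom.stSyn (rscCode i).HZ (T i)) (CSSPhenom.stCycles (rscCode i).HZ (T i))
      hammingNorm)
    {p : ℝ} (hp₀ : 0 ≤ p) (hpp : p < thresholdValue ν) : DecaysExponentially (xPhenomFailureFamily rscCode T D) p := by
  have hp : p ≤ 1 / 2 := hpp.le.trans (thresholdValue_le_half ν)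
  have hlt : p * (1 - p) < thresholdValue ν * (1 - thresholdValue ν) :=
    mul_one_sub_lt_mul_one_sub hpp (by linarith [thresholdValue_le_half ν])
  have hν0 : 0 < ν := lt_of_lt_of_le one_pos hν
  have h4 : 4 * ν ^ 2 * (p * (1 - p)) < 1 := by
    calc 4 * ν ^ 2 * (p * (1 - p)) < 4 * ν ^ 2 * (thresholdValue ν * (1 - thresholdValue ν)) := by gcongr
      _ = 1 := four_mul_sq_mul_thresholdValue hν
  set s := Real.sqrt (p * (1 - p)) with hs
  set r := 2 * ν * s with hr
  have hpp' : 0 ≤ p * (1 - p) := mul_nonneg hp₀ (by linarith)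
  have hr0 : 0 ≤ r := by rw [hr]; positivity
  have hr1 : r < 1 := by
    have hsq : r ^ 2 = 4 * ν ^ 2 * (p * (1 - p)) := by
      rw [hr, mul_pow, mul_pow, hs, Real.sq_sqrt hpp']; ring
    have h' : r ^ 2 < 1 := by rw [hsq]; exact h4
    have := (sq_lt_one_iff_abs_lt_one r).1 h'
    rwa [abs_of_nonneg hr0] at this
  have h1r : 0 < 1 - r := by linarith
  have hC0 : 0 ≤ C := by
    have h0 := hC 0
    rw [SAW.Zd.count_zero, pow_zero, mul_one, Nat.cast_one] at h0
    linarith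
  obtain ⟨A, m, hA⟩ := hT
  refine decaysExponentially_of_eventually_abs_le (A := A * C * r / (1 - r)) (k := m + 1) hr0 hr1 ?_
  refine Filter.Eventually.of_forall fun i => ?_
  have hnonneg : 0 ≤ xPhenomFailureFamily rscCode T D i p := by
    refine Finset.sum_nonneg fun E _ => ?_
    rw [ToricCode.phenomenologicalWeight_self]
    exact bernoulliWeight_nonneg hp₀ (by linarith) _
  rw [abs_of_nonneg hnonneg]
  have hb := rsc_xPhenomFailureFamily_le_of_sawCountBound3 hν0 hC T D hD i hp₀ hp hr1
  have hk : (0 : ℝ) ≤ ((i + 1 : ℕ) : ℝ) := by positivity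
  have hX : 0 ≤ A * ((i : ℝ) + 1) ^ m := (Nat.cast_nonneg (T i)).trans (hA i)
  calc xPhenomFailureFamily rscCode T D i p
      ≤ ((i + 1 : ℕ) : ℝ) * (T i) * C * r ^ (i + 1) / (1 - r) := hb
    _ ≤ ((i + 1 : ℕ) : ℝ) * (A * ((i : ℝ) + 1) ^ m) * C * r ^ (i + 1) / (1 - r) :=
        div_le_div_of_nonneg_right
          (mul_le_mul_of_nonneg_right (mul_le_mul_of_nonneg_right (mul_le_mul_of_nonneg_left (hA i) hk) hC0)
            (pow_nonneg hr0 _)) h1r.le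
    _ = A * C * r / (1 - r) * ((i : ℝ) + 1) ^ (m + 1) * r ^ i := by
        push_cast
        rw [pow_succ, pow_succ]
        ring

/-- **Exponential decay at every `0 ≤ p ≤ .0112`** for the rotated memory experiment (`q = p`, polynomially many rounds, every
minimum-weight space-time decoder family of the `H_Z` sector) — UNCONDITIONAL, tier CERTIFIED (kernel) (cubic walk-count
constant at `ν = 4.75 > μ(ℤ³)`; `.0112 < p₀(4.75)`). [cite: DennisEtAl2002, §5.3 eq. (fail_iso)] -/
theorem rsc_x_phenom_decaysExponentially_0112 {T : ℕ → ℕ} (hT : IsPolyBounded T)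
    (D : ∀ i, CSSPhenom.STDecoder (Fin (i + 1 - 1) × Fin (i + 1 + 1)) (Fin (i + 1) × Fin (i + 1)) (T i))
    (hD : ∀ i, (D i).IsMinWeight (CSSPhenom.stSyn (rscCode i).HZ (T i)) (CSSPhenom.stCycles (rscCode i).HZ (T i))
      hammingNorm)
    {p : ℝ} (hp₀ : 0 ≤ p) (hpp : p ≤ 0.0112) : DecaysExponentially (xPhenomFailureFamily rscCode T D) p := by
  have hlt : SAW.Zd.connectiveConstant 3 < 4.75 :=
    lt_of_le_of_lt SAW.Zd.FiniteMemory3.connectiveConstant_three_le_47476 (by norm_num)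
  obtain ⟨C, hC⟩ := exists_sawCountBound3_of_connectiveConstant_lt hlt
  have hval : (0.0112 : ℝ) < thresholdValue 4.75 := by
    unfold thresholdValue
    have : Real.sqrt (1 - 1 / (4.75 : ℝ) ^ 2) < 0.9776 := by
      rw [Real.sqrt_lt' (by norm_num)]
      norm_num
    linarith
  exact rsc_x_phenom_decaysExponentially_of_sawCountBound3 (by norm_num) hC hT D hD hp₀ (lt_of_le_of_lt hpp hval)

/-! ### Space-time minimum-weight perfect matching with the rough edge as boundary -/

/-- ★ **Rotated phenomenological threshold `≥ p₀(4.7476)` for EVERY space-time boundary-MWPM decoder family** (defects =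
syndrome changes of the `T(i)` rounds matched in the space-time graph with the boundary vertex; any graphlike-with-boundary
presentation `ι i` of `HZ (i+1)` — they exist, `card_colSupp_HZ_le` — any link metric on the space-time lift, tie-break,
geodesics) — UNCONDITIONAL, tier CERTIFIED (kernel). [cite: DennisEtAl2002, §5.1 (E_min on the space-time lattice by matching) and §5.3] -/
theorem rsc_x_phenom_mwpm_isThresholdLowerBound_kernelZ3SymmK12 {T : ℕ → ℕ} (hT : IsPolyBounded T)
    {ι : ∀ i, Fin (i + 1) × Fin (i + 1) → Sym2 (Option (Fin (i + 1 - 1) × Fin (i + 1 + 1)))}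
    (hι : ∀ i, IsGraphlikeVia (rscCode i).HZ (ι i)) (m : ∀ i, EdgeMetric (stEndsOf (ι i) (T i)))
    {D' : ∀ i, Decoder (Option ((Fin (i + 1 - 1) × Fin (i + 1 + 1)) × Fin (T i + 1)) → ZMod 2)
      (HistoryLoc (Fin (i + 1) × Fin (i + 1)) (Fin (i + 1 - 1) × Fin (i + 1 + 1)) (T i) → ZMod 2)}
    (hD : ∀ i, IsMatchingDecoder (m i) (D' i)) :
    IsThresholdLowerBound (xPhenomFailureFamily rscCode T fun i => boundaryDecoder (D' i)) (thresholdValue 4.7476) :=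
  rsc_x_phenom_isThresholdLowerBound_kernelZ3SymmK12 hT _ fun i => isMinWeight_boundaryDecoder_st (hι i) (T i) (hD i)

/-- **`p_c^{MWPM, phenom}(RSC, H_Z sector) > .0112`**, every space-time boundary-MWPM family — UNCONDITIONAL, tier CERTIFIED
(kernel); was `.0101`. [cite: DennisEtAl2002, §5.1 and §5.3 eq. (threshold_iso_num)] -/
theorem rsc_x_phenom_mwpm_accuracyThreshold_gt_0112 {T : ℕ → ℕ} (hT : IsPolyBounded T)
    {ι : ∀ i, Fin (i + 1) × Fin (i + 1) → Sym2 (Option (Fin (i + 1 - 1) × Fin (i + 1 + 1)))}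
    (hι : ∀ i, IsGraphlikeVia (rscCode i).HZ (ι i)) (m : ∀ i, EdgeMetric (stEndsOf (ι i) (T i)))
    {D' : ∀ i, Decoder (Option ((Fin (i + 1 - 1) × Fin (i + 1 + 1)) × Fin (T i + 1)) → ZMod 2)
      (HistoryLoc (Fin (i + 1) × Fin (i + 1)) (Fin (i + 1 - 1) × Fin (i + 1 + 1)) (T i) → ZMod 2)}
    (hD : ∀ i, IsMatchingDecoder (m i) (D' i)) :
    (0.0112 : ℝ) < accuracyThreshold (xPhenomFailureFamily rscCode T fun i => boundaryDecoder (D' i)) :=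
  rsc_x_phenom_accuracyThreshold_gt_0112 hT _ fun i => isMinWeight_boundaryDecoder_st (hι i) (T i) (hD i)

/-- **The `H_Z`-sector memory experiment of the rotated surface codes is below threshold at every `p < .0112`** for every
minimum-weight space-time decoder family and every polynomially bounded schedule (`q = p`) — UNCONDITIONAL, tier CERTIFIED
(kernel). [cite: DennisEtAl2002, §5.3 eq. (threshold_iso_num)] -/
theorem rsc_x_phenom_belowThreshold_0112 {T : ℕ → ℕ} (hT : IsPolyBounded T)
    (D : ∀ i, CSSPhenom.STDecoder (Fin (i + 1 - 1) × Fin (i + 1 + 1)) (Fin (i + 1) × Fin (i + 1)) (T i))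
    (hD : ∀ i, (D i).IsMinWeight (CSSPhenom.stSyn (rscCode i).HZ (T i)) (CSSPhenom.stCycles (rscCode i).HZ (T i))
      hammingNorm) {p : ℝ} (hp₀ : 0 ≤ p) (hpp : p < 0.0112) :
    BelowThreshold (xPhenomFailureFamily rscCode T D) p :=
  (rsc_x_phenom_isThresholdLowerBound_kernelZ3SymmK12 hT D hD).anti thresholdValue_47476_bounds.1.le p hp₀ hpp


end Summit.Ventures.QEC.Thresholds
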